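import Summits.BirchSwinnertonDyer.BirchSwinnertonDyer.Theorems.SylvesterTwoHeegnerIndexCMFlipReductionDatum
import Summits.BirchSwinnertonDyer.BirchSwinnertonDyer.Theorems.SylvesterTwoHeegnerIndexCMFlipLevelPrimePrep
import Summits.BirchSwinnertonDyer.BirchSwinnertonDyer.Theorems.SylvesterTwoHeegnerIndexCMFlipBottomClass
import Summits.BirchSwinnertonDyer.Rank1Residual.X11b.KolyvaginH44OfEulerCongruence
import Literature.NumberTheory.EllipticCurves.KolyvaginClassFlipSupersingular
import Literature.NumberTheory.EllipticCurves.KolyvaginClassLocalConditionCoprimeIndex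
import Literature.NumberTheory.EllipticCurves.HuShuYin2019.SylvesterPairGoodPlaces
import HarnessLib

/-!
# (S5) of leaf (L1) at `p ≡ 7 (mod 9)`, crux `UpperOffV0HSYPlus` (stmt-BirchSwinnertonDyer-19804): #F1's AT-LEVEL
# FLIP at `9pℓ` for an ARBITRARY index set, with the bottom Selmer condition DISPLAYED

Skeleton of record VARIANT M (`Cruxes/UpperOffV0HSYPlus/Lines/coupled_variantM.lean` 406ca288e244d392), stub
`stub_layerL1Seven`; planner D507 (4), D510.  This is g24's #F1 `SylvesterTwoCMFlip.flip_levelPrime` (k-ty1 #14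
INSTANTIATED for the HSY pair at a Kolyvagin prime, (ES2) displayed) with ONE change: the representatives
`t : ι → Γ_K` are an ARBITRARY finite family (no bijectivity onto `Γ_K ⧸ N′`), and the ONLY consequence of
bijectivity that #F1 used — the Selmer condition at `λ` of the bottom class `c(ψ_B(Σᵢ ρ_{tᵢ}(tᵢ • κ⁻¹ι_e y₀)))`
(#F1b `kolyvaginClass_bottom_mem_selmerLocalKer`) — is DISPLAYED as the hypothesis `hsel₂`.  For the HALVED system
at `p ≡ 7 (9)` the index set is `(𝒢₀⧸H) × H′` (half of the bottom transversal), and `hsel₂` is discharged in the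
sequel (#S6) from #S2 (`half_bottom_chiComponent_eq_toGeomPoints`: the half bottom sum is `ι([𝒢₀:H]•Y′ + T₀′)`),
#G `kolyvaginClass_eq_kummerClassOfPoint_of_eq` and `kummerMapTorsion_mem_selmerLocalKer`.  Every other line of
the proof is #F1's VERBATIM (audit trail there).

HONEST FRAMING: theorems only (no definition, no named fact, no instance, no notation); (ES2) and `hsel₂` are
DISPLAYED hypotheses; nothing asserted here; nothing about Ш/BSD; no stub closed; X12.CMAtTwo NOT proved;
`--supports stmt-BirchSwinnertonDyer-19804 --as helper`.  `set_option maxHeartbeats 1600000 in` scoped to the one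
theorem (as #F1).  References: [GrossLMS1991] Prop. 3.7, §4, Prop. 6.2; [McCallumLMS1991] §4, Prop. 4.4;
[Nekovar2007] Prop. 4.9; [HuShuYin2019] §1–§2, §4.1.
-/

set_option linter.dupNamespace false -- Summits modules are `Summit.<Summit>.<Problem>…` by design
set_option autoImplicit false

noncomputable section

open scoped Classical Pointwise

namespace Summit.BirchSwinnertonDyer.BirchSwinnertonDyer.Theorems.SylvesterTwoCMHalf

open WeierstrassCurve Field NumberField IsDedekindDomain Finset
open Literature.NumberTheory.EllipticCurves Literature.NumberTheory.GaloisRepresentations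
  Literature.NumberTheory.EllipticCurves.ModularForms
  Literature.NumberTheory.EllipticCurves.HuShuYin2019
  Literature.NumberTheory.EllipticCurves.KolyvaginCocycle
  Summit.BirchSwinnertonDyer.BirchSwinnertonDyer.Theorems.SylvesterTwoCMData
  Summit.BirchSwinnertonDyer.Rank1Residual.X11b
  Summit.BirchSwinnertonDyer.Rank1Residual.X11b.RingClassTower
  Summit.BirchSwinnertonDyer.BirchSwinnertonDyer.Theorems.SylvesterTwoCMFlip

variable {K : Type} [Field K] [NumberField K]

set_option maxHeartbeats 1600000 in
/-- **THE FLIP at level `9pℓ`, block 1 of leaf (L1), ARBITRARY INDEX SET, bottom Selmer condition displayed** — k-ty1 #14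
(`JZero.zsmul_kolyvaginClass_cubicTwist_mem_selmerLocalKer_iff_mem_torsionLocalKer`) INSTANTIATED for the HSY
pair `(A, B) = (E_{3p²}, E_p)` over `K ∋ ω` in the orientation `(W₁, W₂) = (A_K, B_K)`, at a Kolyvagin prime
`ℓ ≡ 2 (3)` of the pair at `2` and the place `λ ∋ ℓ`: for the coupled frame (`v_B, v_A = 3v_B², ψ_B, ψ_A, ρ`,
#R-g), an embedded `K[9pℓ]` (`emb`, `N`, the `K[9p]`-fixer `N'`, representatives `t`), a generator `σ_ℓ` of
`Gal(K[9pℓ]/K[9p])`, HSY's CM points `y_ℓ`, `y₁` of conductors `9pℓ`, `9p` on the minimal model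
`W₀ = (y² + y = x³ − 1)` (read in `K[9pℓ]`, #R-a), the derived point `P_ℓ = κ⁻¹ ι(D_ℓ y_ℓ)` and the bottom
point `P₁ = κ⁻¹ ι(y₁)` in the frame `E₉ = (cubeSumCurve 9)_K`:
**`c(ψ_A (P_ℓ^{χ_A}))` is Selmer at `λ` iff `c(ψ_B (P₁^{χ_B})) ∈ T_B(λ)`** (`P^{χ_A} = Σᵢ ρ²_{tᵢ}(tᵢ P)`,
`P^{χ_B} = Σᵢ ρ_{tᵢ}(tᵢ P)`), GRANTED the reduction congruence (ES2) `red(g y_ℓ) = Frob_ℓ red(g y₁)` for all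
`g ∈ Γ_K` at the prime of the tree's `geomReduction` (Gross 1991 Prop. 3.7 (2) / Nekovář 2007 Prop. 4.9 for
HSY's tower — displayed, hypothesis `hES`).  Every other binder of #14 is DISCHARGED here: the frame laws
(#R-g, #R-h `rho_rho_rho_eq`), `Γ_K/N` abelian, good reduction of `A_K`, `B_K` at `λ` (k-ty1 #11), the prime
`𝔐`, an arithmetic Frobenius `F` fixing `B[2]` (`exists_isArithFrobAt_mem_torsionFixing`), `E₂[2] ≃ E₂(K̄_λ)[2]`,
`F v_B = v_B` and `I_𝔓 v_A = v_A` (#17b §4: the decomposition group above `λ` fixes `emb K[9p] ∋ ∛3, ∛p`),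
the reduction datum of the frame (`exists_frame_reductionDatum`), the inertia generator `τ₀ ↦ σ_ℓ` (#17b §3),
THE ROOT `R = l' • κ⁻¹ ι(y_ℓ)` of `P_ℓ` (`(σ_ℓ − 1) D_ℓ = (ℓ + 1) − Tr_ℓ`, (ES1) with `a_ℓ(E₉) = 0`), its
FLIPPED reduction from (ES2), `F P₁^{χ_B} = P₁^{χ_B}` and the Selmer condition of the bottom class at `λ`
(Gross 6.2 (1) at the unramified level `9p`, k-ty1 #11, moved to `A₂ = ψ_B(E₉(K̄)^N)` by #R-h `kolyvaginClass_mono`).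
[cite: GrossLMS1991, Prop. 3.7, Prop. 6.2, §4 (4.1)–(4.6)] [cite: McCallumLMS1991, Prop. 4.4, §4 (4)–(6)]
[cite: HuShuYin2019, §1 p. 4, §2 Prop. 2.4, §4.1] [cite: Nekovar2007, Prop. 4.9, Prop. 4.13 (ii)] -/
theorem flip_levelPrime_of_bottomSelmer {ω : K} (hω : ω ^ 2 + ω + 1 = 0) (h2 : Module.finrank ℚ K = 2)
    (ι : K →+* ℂ) [(⟨0, 0, 1, 0, -1⟩ : WeierstrassCurve ℚ).IsElliptic]
    [(⟨0, 0, 1, 0, -1⟩ : WeierstrassCurve ℚ).IsGloballyMinimal]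
    (Dt : ModularParametrizationData (⟨0, 0, 1, 0, -1⟩ : WeierstrassCurve ℚ) 243)
    {p ℓ : ℕ} (hp : p.Prime) (hp3 : p % 3 = 1) [Fact ℓ.Prime] (hℓ3 : ℓ % 3 = 2) (hℓ2 : ℓ ≠ 2)
    (hℓp : ¬ ℓ ∣ p)
    (hℓA : ¬ ℓ ∣ (cubeSumCurve (3 * (p : ℚ) ^ 2)).conductorNorm ℤ)
    (hℓB : ¬ ℓ ∣ (cubeSumCurve (p : ℚ)).conductorNorm ℤ)
    (hℓdK : ¬ ((ℓ : ℤ) ∣ NumberField.discr K))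
    (hFrobB : FrobEqFrobInfty (cubeSumCurve (p : ℚ)) K 2 ℓ)
    (hΔ : ¬ (ℓ : ℤ) ∣ minimalDiscriminantInt (⟨0, 0, 1, 0, -1⟩ : WeierstrassCurve ℚ))
    -- the frame transport `E₉(K̄) ≃+ W₀(K̄)`
    (κ : geomPoints ((cubeSumCurve 9).baseChange K) ≃+
      geomPoints ((⟨0, 0, 1, 0, -1⟩ : WeierstrassCurve ℚ).baseChange K))
    (hκG : ∀ (g : absoluteGaloisGroup K) (P : geomPoints ((cubeSumCurve 9).baseChange K)),
      κ (g • P) = g • κ P)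
    {a b d : AlgebraicClosure K}
    (hκ : ∀ {x y : AlgebraicClosure K}
      (h : (((cubeSumCurve 9).baseChange K).baseChange (AlgebraicClosure K)).toAffine.Nonsingular x y),
      ∃ h', κ (.some x y h) = .some (a * x) (b * y + d) h')
    -- the coupled frame (#R-g `exists_coupledFrame`)
    {vB vA : AlgebraicClosure K} (hvBc : vB ^ 3 = algebraMap ℚ (AlgebraicClosure K) ((p : ℚ) / 9))
    (hvB : vB ≠ 0)
    (hvAc : vA ^ 3 = algebraMap ℚ (AlgebraicClosure K) ((p : ℚ) ^ 2 / 3)) (hvA0 : vA ≠ 0)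
    (hvB3 : ∀ g : absoluteGaloisGroup K,
      ((show AlgebraicClosure K ≃ₐ[K] AlgebraicClosure K from g) vB) ^ 3 = vB ^ 3)
    (hvA3 : ∀ g : absoluteGaloisGroup K,
      ((show AlgebraicClosure K ≃ₐ[K] AlgebraicClosure K from g) vA) ^ 3 = vA ^ 3)
    {ψB : geomPoints ((cubeSumCurve 9).baseChange K) ≃+ geomPoints ((cubeSumCurve (p : ℚ)).baseChange K)}
    {ψA : geomPoints ((cubeSumCurve 9).baseChange K) ≃+
      geomPoints ((cubeSumCurve (3 * (p : ℚ) ^ 2)).baseChange K)}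
    (hψB : ∀ {x y : AlgebraicClosure K}
      (h : (((cubeSumCurve 9).baseChange K).baseChange (AlgebraicClosure K)).toAffine.Nonsingular x y),
      ∃ h', ψB (Affine.Point.some x y h) = Affine.Point.some (vB ^ 2 * x) (vB ^ 3 * y) h')
    (hψA : ∀ {x y : AlgebraicClosure K}
      (h : (((cubeSumCurve 9).baseChange K).baseChange (AlgebraicClosure K)).toAffine.Nonsingular x y),
      ∃ h', ψA (Affine.Point.some x y h) = Affine.Point.some (vA ^ 2 * x) (vA ^ 3 * y) h')
    {ρ : absoluteGaloisGroup K →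
      geomPoints ((cubeSumCurve 9).baseChange K) ≃+ geomPoints ((cubeSumCurve 9).baseChange K)}
    (hρ : ∀ (g : absoluteGaloisGroup K) {x y : AlgebraicClosure K}
        (h : (((cubeSumCurve 9).baseChange K).baseChange (AlgebraicClosure K)).toAffine.Nonsingular x y),
        ∃ h', ρ g (Affine.Point.some x y h) =
          Affine.Point.some (((show AlgebraicClosure K ≃ₐ[K] AlgebraicClosure K from g) vB / vB) ^ 2 * x)
            y h')
    (hρρ : ∀ (g : absoluteGaloisGroup K) {x y : AlgebraicClosure K}
        (h : (((cubeSumCurve 9).baseChange K).baseChange (AlgebraicClosure K)).toAffine.Nonsingular x y),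
        ∃ h', ρ g (ρ g (Affine.Point.some x y h)) =
          Affine.Point.some (((show AlgebraicClosure K ≃ₐ[K] AlgebraicClosure K from g) vA / vA) ^ 2 * x)
            y h')
    (hlawB : ∀ (g : absoluteGaloisGroup K) (P : geomPoints ((cubeSumCurve 9).baseChange K)),
        g • ψB P = ψB (ρ g (g • P)))
    (hlawA : ∀ (g : absoluteGaloisGroup K) (P : geomPoints ((cubeSumCurve 9).baseChange K)),
        g • ψA P = ψA (ρ g (ρ g (g • P))))
    (hρcomm : ∀ (g h : absoluteGaloisGroup K) (P : geomPoints ((cubeSumCurve 9).baseChange K)),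
        h • ρ g P = ρ g (h • P))
    -- the level `K[9pℓ]`: embedding, fixer, the `K[9p]`-fixer, representatives
    (emb : ringClassField K ι (9 * p * ℓ) →+* AlgebraicClosure K)
    (hemb : ∀ k : K, emb (algebraMap K (ringClassField K ι (9 * p * ℓ)) k) =
      algebraMap K (AlgebraicClosure K) k)
    (ιe : letI : DecidableEq (ringClassField K ι (9 * p * ℓ)) := fun a b ↦ Classical.propDecidable (a = b)
      ((⟨0, 0, 1, 0, -1⟩ : WeierstrassCurve ℚ).baseChange (ringClassField K ι (9 * p * ℓ))).toAffine.Point →+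
        geomPoints ((⟨0, 0, 1, 0, -1⟩ : WeierstrassCurve ℚ).baseChange K))
    (hιe : ∀ P, ιe P = Affine.Point.map (W' := (⟨0, 0, 1, 0, -1⟩ : WeierstrassCurve ℚ)) emb.toRatAlgHom P)
    (N : Subgroup (absoluteGaloisGroup K))
    (hN : ∀ g : absoluteGaloisGroup K, g ∈ N ↔
      ∀ x : ringClassField K ι (9 * p * ℓ),
        (show AlgebraicClosure K ≃ₐ[K] AlgebraicClosure K from g) (emb x) = emb x)
    (N' : Subgroup (absoluteGaloisGroup K))
    (hN' : ∀ g : absoluteGaloisGroup K, g ∈ N' ↔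
      ∀ x ∈ {x : ringClassField K ι (9 * p * ℓ) | (x : ℂ) ∈ ringClassField K ι (9 * p)},
        (show AlgebraicClosure K ≃ₐ[K] AlgebraicClosure K from g) (emb x) = emb x)
    {ιt : Type} [Fintype ιt] (t : ιt → absoluteGaloisGroup K)
    -- the generator `σ_ℓ` and HSY's CM points of conductor `9pℓ`, `9p`
    {σ : ringClassField K ι (9 * p * ℓ) ≃ₐ[ℚ] ringClassField K ι (9 * p * ℓ)}
    (hσ : Subgroup.zpowers σ = ringClassGalOver ι (9 * p * ℓ) (9 * p))
    {y y₀ : ((⟨0, 0, 1, 0, -1⟩ : WeierstrassCurve ℚ).baseChange (ringClassField K ι (9 * p * ℓ))).toAffine.Point}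
    (hy : Affine.Point.map (W' := (⟨0, 0, 1, 0, -1⟩ : WeierstrassCurve ℚ))
        (ringClassField K ι (9 * p * ℓ)).subtype.toRatAlgHom y =
      Dt.φ (heegnerTau ((ℓ : ℤ) ^ 2 * (81 * ((p : ℤ) ^ 2 + 4 * p + 16)),
        (ℓ : ℤ) * (-(9 * (4 * (p : ℤ) ^ 2 + 17 * p + 72))), 4 * (p : ℤ) ^ 2 + 18 * p + 81)))
    (hy₀ : Affine.Point.map (W' := (⟨0, 0, 1, 0, -1⟩ : WeierstrassCurve ℚ))
        (ringClassField K ι (9 * p * ℓ)).subtype.toRatAlgHom y₀ =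
      Dt.φ (heegnerTau (81 * ((p : ℤ) ^ 2 + 4 * p + 16), -(9 * (4 * (p : ℤ) ^ 2 + 17 * p + 72)),
        4 * (p : ℤ) ^ 2 + 18 * p + 81)))
    -- the classes' admissibility / invariance inputs (#R-g `coupledFrame_levelPackage`)
    {hdivA : ∀ P : geomPoints ((cubeSumCurve (3 * (p : ℚ) ^ 2)).baseChange K),
      ∃ R : geomPoints ((cubeSumCurve (3 * (p : ℚ) ^ 2)).baseChange K), ((2 : ℕ) : ℤ) • R = P}
    {hdivB : ∀ P : geomPoints ((cubeSumCurve (p : ℚ)).baseChange K),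
      ∃ R : geomPoints ((cubeSumCurve (p : ℚ)).baseChange K), ((2 : ℕ) : ℤ) • R = P}
    (hA₁ : IsAdmissible (absoluteGaloisGroup K)
      ((FixedPoints.addSubgroup N (geomPoints ((cubeSumCurve 9).baseChange K))).map ψA.toAddMonoidHom)
      ((2 : ℕ) : ℤ))
    (hA₂ : IsAdmissible (absoluteGaloisGroup K)
      ((FixedPoints.addSubgroup N (geomPoints ((cubeSumCurve 9).baseChange K))).map ψB.toAddMonoidHom)
      ((2 : ℕ) : ℤ))
    (hP₁ : ψA (∑ i, ρ (t i) (ρ (t i) (t i •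
        κ.symm (ιe (KolyvaginOperator.derivOp
          (pointGalHom (⟨0, 0, 1, 0, -1⟩ : WeierstrassCurve ℚ) (ringClassField K ι (9 * p * ℓ))) σ ℓ y))))) ∈
      invPoints (absoluteGaloisGroup K)
        ((FixedPoints.addSubgroup N (geomPoints ((cubeSumCurve 9).baseChange K))).map ψA.toAddMonoidHom)
        ((2 : ℕ) : ℤ))
    (hP₂ : ψB (∑ i, ρ (t i) (t i • κ.symm (ιe y₀))) ∈
      invPoints (absoluteGaloisGroup K)
        ((FixedPoints.addSubgroup N (geomPoints ((cubeSumCurve 9).baseChange K))).map ψB.toAddMonoidHom)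
        ((2 : ℕ) : ℤ))
    -- (ES2): Gross 3.7 (2) / Nekovář 4.9 for HSY's CM points at the conductors `(9pℓ, 9p)` — DISPLAYED
    (hES : ∀ (φ₀ : absoluteGaloisGroup (ZMod ℓ)), (∀ x : AlgebraicClosure (ZMod ℓ), φ₀ • x = x ^ ℓ) →
      ∀ g : absoluteGaloisGroup K,
        geomReduction hΔ ((RatClosure.pointsEquiv (K := K) (⟨0, 0, 1, 0, -1⟩ : WeierstrassCurve ℚ)).symm
            (g • ιe y)) =
          φ₀ • geomReduction hΔ ((RatClosure.pointsEquiv (K := K)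
            (⟨0, 0, 1, 0, -1⟩ : WeierstrassCurve ℚ)).symm (g • ιe y₀)))
    -- the place
    (v : HeightOneSpectrum (𝓞 K)) (hv : (ℓ : 𝓞 K) ∈ v.asIdeal)
    -- the Selmer condition at `λ` of the bottom class — DISPLAYED (for a full transversal: #F1b)
    (hsel₂ : kolyvaginClass ((cubeSumCurve (p : ℚ)).baseChange K) ((2 : ℕ) : ℤ) hdivB hA₂
        (ψB (∑ i, ρ (t i) (t i • κ.symm (ιe y₀)))) hP₂ ∈
      selmerLocalKer ((cubeSumCurve (p : ℚ)).baseChange K) (v.adicCompletion K) ((2 : ℕ) : ℤ)) :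
    kolyvaginClass ((cubeSumCurve (3 * (p : ℚ) ^ 2)).baseChange K) ((2 : ℕ) : ℤ) hdivA hA₁
        (ψA (∑ i, ρ (t i) (ρ (t i) (t i •
          κ.symm (ιe (KolyvaginOperator.derivOp
            (pointGalHom (⟨0, 0, 1, 0, -1⟩ : WeierstrassCurve ℚ) (ringClassField K ι (9 * p * ℓ)))
            σ ℓ y)))))) hP₁ ∈
        selmerLocalKer ((cubeSumCurve (3 * (p : ℚ) ^ 2)).baseChange K) (v.adicCompletion K) ((2 : ℕ) : ℤ) ↔
      kolyvaginClass ((cubeSumCurve (p : ℚ)).baseChange K) ((2 : ℕ) : ℤ) hdivB hA₂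
          (ψB (∑ i, ρ (t i) (t i • κ.symm (ιe y₀)))) hP₂ ∈
        ((cubeSumCurve (p : ℚ)).baseChange K).torsionLocalKer (v.adicCompletion K) ((2 : ℕ) : ℤ) := by
  -- ### basics
  have hℓ : ℓ.Prime := Fact.out
  have hK := JZero.isImaginaryQuadratic_of_sq_add_self_add_one hω h2
  have hdK := JZero.discr_eq_neg_three_of_sq_add_self_add_one hω h2
  have hinert := JZero.span_natCast_isPrime_of_mod_three_eq_two hω h2 hℓ hℓ3
  have hp0 : p ≠ 0 := hp.ne_zero
  have hp0' : (p : ℚ) ≠ 0 := by exact_mod_cast hp0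
  have hp2 : p ≠ 2 := by rintro rfl; norm_num at hp3
  have hp3' : p ≠ 3 := by rintro rfl; norm_num at hp3
  have hℓ3' : ℓ ≠ 3 := by rintro rfl; simp at hℓ3
  have hℓ9 : ¬ ℓ ∣ 9 := by
    intro h
    have h' : ℓ ∣ 3 ^ 2 := by norm_num; exact h
    exact hℓ3' ((Nat.prime_dvd_prime_iff_eq hℓ Nat.prime_three).mp (hℓ.dvd_of_dvd_pow h'))
  have hℓ9p : ¬ ℓ ∣ 9 * p := by
    intro h
    rcases (Nat.Prime.dvd_mul hℓ).mp h with h9 | hp'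
    · exact hℓ9 h9
    · exact hℓp hp'
  have hf : 9 * p ≠ 0 := mul_ne_zero (by norm_num) hp0
  have hn0 : 9 * p * ℓ ≠ 0 := mul_ne_zero hf hℓ.ne_zero
  haveI := (finiteDimensional_and_isGalois_ringClassField hK ι hn0).1
  haveI := (finiteDimensional_and_isGalois_ringClassField hK ι hn0).2
  haveI hBell : ((cubeSumCurve (p : ℚ)).baseChange K).IsElliptic := isElliptic_cubeSumCurve_baseChange K hp0'
  haveI hAell : ((cubeSumCurve (3 * (p : ℚ) ^ 2)).baseChange K).IsElliptic :=
    isElliptic_cubeSumCurve_baseChange K (by positivity)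
  haveI hBellQ : (cubeSumCurve (p : ℚ)).IsElliptic := by
    have h := isElliptic_cubeSumCurve_baseChange ℚ hp0'
    rwa [WeierstrassCurve.baseChange, Algebra.algebraMap_self, WeierstrassCurve.map_id] at h
  haveI hNn : N.Normal := normal_of_mem_iff emb hemb N hN
  have hNN' : N ≤ N' := le_of_mem_iff_of_mem_iff_forall emb hN hN'
  have hcomm := commutator_mem_of_ringClassField hK ι hn0 emb hemb N hN
  -- `N'` (hence `N`) fixes the cube roots `v_B`, `v_A`
  have hN'B := forall_apply_eq_of_pow_three_eq_div_nine_of_fix_nine_mul hω h2 ι hp0 hℓ.ne_zero emb hemb N' hN'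
  have hN'A := forall_apply_eq_of_pow_three_eq_sq_div_three_of_fix_nine_mul hω h2 ι hp0 hℓ.ne_zero emb hemb
    N' hN'
  have hN'vB : ∀ h ∈ N', (show AlgebraicClosure K ≃ₐ[K] AlgebraicClosure K from h) vB = vB :=
    fun h hh ↦ hN'B h hh vB hvBc
  have hN'vA : ∀ h ∈ N', (show AlgebraicClosure K ≃ₐ[K] AlgebraicClosure K from h) vA = vA :=
    fun h hh ↦ hN'A h hh vA hvAc
  have hNvB : ∀ h ∈ N, (show AlgebraicClosure K ≃ₐ[K] AlgebraicClosure K from h) vB = vB :=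
    fun h hh ↦ hN'vB h (hNN' hh)
  have hNvA : ∀ h ∈ N, (show AlgebraicClosure K ≃ₐ[K] AlgebraicClosure K from h) vA = vA :=
    fun h hh ↦ hN'vA h (hNN' hh)
  -- the `ρ ∘ ρ` family as additive equivalences (block 1: `W₁ = A_K`, cocycle `ρ_A = ρ ∘ ρ`; `ρ' = ρ`)
  have hρρ' : ∀ (g : absoluteGaloisGroup K) {x y : AlgebraicClosure K}
      (h : (((cubeSumCurve 9).baseChange K).baseChange (AlgebraicClosure K)).toAffine.Nonsingular x y),
      ∃ h', (fun g ↦ (ρ g).trans (ρ g)) g (Affine.Point.some x y h) =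
        Affine.Point.some (((show AlgebraicClosure K ≃ₐ[K] AlgebraicClosure K from g) vA / vA) ^ 2 * x)
          y h' := fun g x y h ↦ hρρ g h
  have hρ' : ∀ (g : absoluteGaloisGroup K) (x : geomPoints ((cubeSumCurve 9).baseChange K)),
      ρ g x = (fun g ↦ (ρ g).trans (ρ g)) g ((fun g ↦ (ρ g).trans (ρ g)) g x) := fun g x ↦ by
    change ρ g x = ρ g (ρ g (ρ g (ρ g x)))
    rw [rho_rho_rho_eq hvB hvB3 hρ g (ρ g x)]
  have hρρcomm : ∀ (g h : absoluteGaloisGroup K) (x : geomPoints ((cubeSumCurve 9).baseChange K)),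
      h • (fun g ↦ (ρ g).trans (ρ g)) g x = (fun g ↦ (ρ g).trans (ρ g)) g (h • x) := fun g h x ↦ by
    change h • ρ g (ρ g x) = ρ g (ρ g (h • x))
    rw [hρcomm, hρcomm]
  -- ### the Kolyvagin-prime structure for `B`, the place, `𝔐`, the Frobenius
  have hKolB : IsKolyvaginPrime ((cubeSumCurve (p : ℚ)).conductorNorm ℤ) (cubeSumCurve (p : ℚ)) K 2 ℓ :=
    ⟨hℓ, hℓB, hℓdK, hℓ2, hinert, hFrobB⟩
  have hvpl : v = hKolB.place := hKolB.mem_iff.mp hv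
  have huniq : ∀ w : HeightOneSpectrum (𝓞 K), (ℓ : 𝓞 K) ∈ w.asIdeal → w = v :=
    fun w hw ↦ (hKolB.mem_iff.mp hw).trans hvpl.symm
  have hres : v.residueCard = ℓ ^ 2 := by rw [hvpl]; exact KolyvaginH44.residueCard_place_eq_sq hK hKolB
  haveI : CharZero (v.adicCompletion K) :=
    charZero_of_injective_algebraMap (algebraMap K (v.adicCompletion K)).injective
  obtain ⟨𝔐, h𝔐⟩ := v.localPrimesAbove_nonempty
  have h𝔓 : v.primeBelow (closureEmb (K := K) (v.adicCompletion K)) 𝔐 ∈ v.primesAbove :=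
    HeightOneSpectrum.primeBelow_mem_primesAbove h𝔐
  have hℓM : FrobEqFrobInfty (cubeSumCurve (p : ℚ)) K (2 ^ 1) ℓ := by rw [pow_one]; exact hFrobB
  have h𝔔 : v.primeBelow (closureEmb (K := K) (v.adicCompletion K)) 𝔐 ∈ hKolB.place.primesAbove := by
    rw [← hvpl]; exact h𝔓
  obtain ⟨F, hF, hFfix⟩ := exists_isArithFrobAt_mem_torsionFixing (cubeSumCurve (p : ℚ)) hK hKolB hℓM h𝔔
  have hsurj := (torsionPointsMap_bijective ((cubeSumCurve (p : ℚ)).baseChange K) (v.adicCompletion K)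
    (show (2 ^ 1 : ℕ) ≠ 0 by norm_num)).2
  -- the place is good for `A_K`, `B_K` and prime to `2`
  have h3v : ((3 : ℕ) : 𝓞 K) ∉ v.asIdeal := not_natCast_mem_of_prime_ne hℓ Nat.prime_three hℓ3' v hv
  have hpv : ((p : ℕ) : 𝓞 K) ∉ v.asIdeal :=
    not_natCast_mem_of_prime_ne hℓ hp (fun h ↦ hℓp (h ▸ dvd_rfl)) v hv
  have h2v : ((2 : ℕ) : 𝓞 K) ∉ v.asIdeal := not_natCast_mem_of_prime_ne hℓ Nat.prime_two hℓ2 v hv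
  have hgoodA := hasGoodReductionAt_cubeSumCurve_three_mul_sq_baseChange (K := K) hp hp2 v h3v hpv
  have hgoodB := hasGoodReductionAt_cubeSumCurve_prime_baseChange (K := K) hp hp2 v h3v hpv
  -- ### the inertia package: `τ₀ ↦ σ_ℓ`, and `I_𝔓, F ∈ N'`
  obtain ⟨⟨τ₀, hτ₀, hτ₀σ, hI⟩, hIN', hFN'⟩ := inertia_package hK ι hf hℓ hℓ9p hv hinert emb hemb h𝔓 hσ N hN
    N' hN' (geomPoints ((cubeSumCurve (3 * (p : ℚ) ^ 2)).baseChange K))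
  have hFmem : F ∈ N' := hFN' F hF
  have hFvB : (show AlgebraicClosure K ≃ₐ[K] AlgebraicClosure K from F) vB = vB := hN'vB F hFmem
  have hIvA : ∀ τ ∈ (v.primeBelow (closureEmb (K := K) (v.adicCompletion K)) 𝔐).inertia
      (absoluteGaloisGroup K), (show AlgebraicClosure K ≃ₐ[K] AlgebraicClosure K from τ) vA = vA :=
    fun τ hτ ↦ hN'vA τ (hIN' τ hτ)
  -- ### the reduction datum of the frame for `ρ_A = ρ ∘ ρ`
  obtain ⟨φ₀, hφ₀'⟩ := exists_frobenius_absoluteGaloisGroup (ZMod ℓ)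
  have hφ₀ : ∀ x : AlgebraicClosure (ZMod ℓ), φ₀ • x = x ^ ℓ := fun x ↦ by rw [hφ₀' x, Nat.card_zmod]
  obtain ⟨-, l', hl'⟩ := IsKolyvaginPrime.pow_dvd_add_one (cubeSumCurve (p : ℚ)) Nat.prime_two hKolB
    (le_refl 1) hℓM
  obtain ⟨g₀, red, φ, ρt, hredg, hφ, hredρ, hφρ, hredI, hredF, hinj, hBn, hχ⟩ :=
    exists_frame_reductionDatum (K := K) hℓ3 hℓ2 hΔ hl' κ hκG hκ hvA0 hvA3 (fun g ↦ (ρ g).trans (ρ g)) hρρ'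
      hv huniq hres h𝔓 hF hφ₀
  -- ### the points: `P_ℓ = κ⁻¹ ι(D_ℓ y)`, `P₁ = κ⁻¹ ι(y₀)`; invariances
  have hκs : ∀ (g : absoluteGaloisGroup K) (Q : geomPoints ((⟨0, 0, 1, 0, -1⟩ : WeierstrassCurve ℚ).baseChange K)),
      κ.symm (g • Q) = g • κ.symm Q := fun g Q ↦ by
    apply κ.injective
    rw [hκG, κ.apply_symm_apply, κ.apply_symm_apply]
  have hPnN := mem_fixedPoints_symm_of_equivariant κ hκG N
    (map_emb_mem_fixedPoints (⟨0, 0, 1, 0, -1⟩ : WeierstrassCurve ℚ) ι emb ιe hιe N hN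
      (KolyvaginOperator.derivOp
        (pointGalHom (⟨0, 0, 1, 0, -1⟩ : WeierstrassCurve ℚ) (ringClassField K ι (9 * p * ℓ))) σ ℓ y))
  have hPnN' : ∀ h ∈ N, h • κ.symm (ιe (KolyvaginOperator.derivOp
      (pointGalHom (⟨0, 0, 1, 0, -1⟩ : WeierstrassCurve ℚ) (ringClassField K ι (9 * p * ℓ))) σ ℓ y)) =
      κ.symm (ιe (KolyvaginOperator.derivOp
        (pointGalHom (⟨0, 0, 1, 0, -1⟩ : WeierstrassCurve ℚ) (ringClassField K ι (9 * p * ℓ))) σ ℓ y)) :=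
    (JZero.mem_fixedPoints_iff _ N _).mp hPnN
  -- the bottom point `y₀` comes from `K[9p]`: it is `N'`-fixed
  have hPmN' := smul_symm_bottom_eq_self hω h2 ι Dt hp3 hℓ.ne_zero κ hκG emb ιe hιe N' hN' hy₀
  have hPmN : ∀ h ∈ N, h • κ.symm (ιe y₀) = κ.symm (ιe y₀) := fun h hh ↦ hPmN' h (hNN' hh)
  have hPmfix : κ.symm (ιe y₀) ∈ FixedPoints.addSubgroup N (geomPoints ((cubeSumCurve 9).baseChange K)) :=
    (JZero.mem_fixedPoints_iff _ N _).mpr hPmN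
  -- ### the inertia generator on `A₁ = ψ_A(E₉(K̄)^N)`
  have hIτ₀ : ∀ τ ∈ (v.primeBelow (closureEmb (K := K) (v.adicCompletion K)) 𝔐).inertia
      (absoluteGaloisGroup K), ∃ i : ℕ,
      ∀ x ∈ (FixedPoints.addSubgroup N (geomPoints ((cubeSumCurve 9).baseChange K))).map
        ψA.toAddMonoidHom, τ • x = (τ₀ ^ i) • x := by
    intro τ hτ
    obtain ⟨i, -, hi⟩ := hI τ hτ
    refine ⟨i, fun x hx ↦ hi x ?_⟩
    obtain ⟨z, hz, rfl⟩ := hx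
    exact (JZero.forall_smul_cubicTwist_eq_iff hψA (N := (N : Set (absoluteGaloisGroup K))) hNvA z).mpr
      ((JZero.mem_fixedPoints_iff _ N _).mp hz)
  -- ### THE ROOT `R = l' • κ⁻¹ ι(y_ℓ)`
  have hDσ := pointGalHom_derivOp_sub_eq hω h2 ι Dt hp3 hℓ hℓ3 hℓ2 hℓp hσ hy hy₀
  have hτ₀D : τ₀ • κ.symm (ιe (KolyvaginOperator.derivOp
        (pointGalHom (⟨0, 0, 1, 0, -1⟩ : WeierstrassCurve ℚ) (ringClassField K ι (9 * p * ℓ))) σ ℓ y)) -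
      κ.symm (ιe (KolyvaginOperator.derivOp
        (pointGalHom (⟨0, 0, 1, 0, -1⟩ : WeierstrassCurve ℚ) (ringClassField K ι (9 * p * ℓ))) σ ℓ y)) =
      ((ℓ + 1 : ℕ) : ℤ) • κ.symm (ιe y) := by
    rw [← hκs, ← map_sub κ.symm, ← map_zsmul κ.symm]
    congr 1
    -- the finite-level identity read in `E₉… W₀(K̄)` along `emb`; the group law of `W₀(K[9pℓ])` under the
    -- classical `DecidableEq` of `ιe`'s binder agrees with the genuine one (`convert`)
    exact smul_embPoints_sub_eq_zsmul (⟨0, 0, 1, 0, -1⟩ : WeierstrassCurve ℚ) emb ιe hιe τ₀ σ hτ₀σ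
      (by convert hDσ)
  have hR : ((2 ^ 1 : ℕ) : ℤ) • (l' • κ.symm (ιe y)) =
      τ₀ • κ.symm (ιe (KolyvaginOperator.derivOp
        (pointGalHom (⟨0, 0, 1, 0, -1⟩ : WeierstrassCurve ℚ) (ringClassField K ι (9 * p * ℓ))) σ ℓ y)) -
      κ.symm (ιe (KolyvaginOperator.derivOp
        (pointGalHom (⟨0, 0, 1, 0, -1⟩ : WeierstrassCurve ℚ) (ringClassField K ι (9 * p * ℓ))) σ ℓ y)) := by
    rw [hτ₀D, smul_smul, hl']
    norm_num
  have hyN := mem_fixedPoints_symm_of_equivariant κ hκG N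
    (map_emb_mem_fixedPoints (⟨0, 0, 1, 0, -1⟩ : WeierstrassCurve ℚ) ι emb ιe hιe N hN y)
  have hRN : l' • κ.symm (ιe y) ∈ FixedPoints.addSubgroup N (geomPoints ((cubeSumCurve 9).baseChange K)) :=
    AddSubgroup.zsmul_mem _ hyN l'
  have hRA : ψA (∑ i, (fun g ↦ (ρ g).trans (ρ g)) (t i) (t i • (l' • κ.symm (ιe y)))) ∈
      (FixedPoints.addSubgroup N (geomPoints ((cubeSumCurve 9).baseChange K))).map ψA.toAddMonoidHom := by
    refine ⟨_, ?_, rfl⟩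
    exact KolyvaginCocycle.chiComponent_mem (fun g ↦ ((fun g ↦ (ρ g).trans (ρ g)) g).toAddMonoidHom)
      (fun g _ ha ↦ JZero.smul_mem_fixedPoints _ N g ha)
      (fun g _ ha ↦ JZero.rho_mem_fixedPoints _ hω hvA0 hvA3 hρρ' N g ha) t hRN
  -- the FLIPPED reduction of the root, from (ES2)
  have hRred : ∀ i, red (t i • (l' • κ.symm (ιe y))) = l' • φ (red (t i • κ.symm (ιe y₀))) := by
    intro i
    rw [KolyvaginCocycle.smul_zsmul_comm, map_zsmul, hredg, hredg, ← hκs, ← hκs, κ.apply_symm_apply,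
      κ.apply_symm_apply, ← mul_smul, ← mul_smul, hES φ₀ hφ₀ (g₀⁻¹ * t i), hφ]
  -- ### `F` fixes `P₁^{χ_B}`, and the bottom class is Selmer at `λ`
  have hFP₂ : F • ψB (∑ i, ρ (t i) (t i • κ.symm (ιe y₀))) = ψB (∑ i, ρ (t i) (t i • κ.symm (ιe y₀))) := by
    rw [hlawB, JZero.smul_chiComponent_eq_self hω hvB hvB3 hρ N hcomm t hPmN (hPmN' F hFmem),
      JZero.rho_apply_of_apply_eq hvB hρ hFvB]
  -- ### ONE CALL of k-ty1 #14
  have key := JZero.zsmul_kolyvaginClass_cubicTwist_mem_selmerLocalKer_iff_mem_torsionLocalKer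
    (W := (cubeSumCurve 9).baseChange K) (W₁ := (cubeSumCurve (3 * (p : ℚ) ^ 2)).baseChange K)
    (W₂ := (cubeSumCurve (p : ℚ)).baseChange K) Nat.prime_two (M := 1) hψA hψB
    (fun g ↦ (ρ g).trans (ρ g)) ρ hρ' hρρcomm N hcomm t hPnN' (hdiv₁ := hdivA) (hdiv₂ := hdivB)
    hA₁ hA₂ hP₁ hP₂ hgoodA hgoodB h2v h𝔐 hF hFfix hsurj hFvB hIvA red φ ρt hredρ hφρ hredI hredF hinj
    hBn hχ hτ₀ hIτ₀ hR hRA hRred hFP₂ hsel₂ 1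
  rw [one_zsmul, one_zsmul] at key
  exact key

end Summit.BirchSwinnertonDyer.BirchSwinnertonDyer.Theorems.SylvesterTwoCMHalf

end
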